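import Mathlib
import Summits.Parity.BatemanHorn.Theorems.IsogenyRedeiTypeIMainTermExactIdentity
import Summits.Parity.BatemanHorn.Theorems.IsogenyRedeiTypeIMainTermSubsetAlgebra

/-!
# Crux `PolyMobiusTail` (stmt-Parity-0870), line `Sketch` (natural form): stub `stub_coeff_aFun_eq_sum`

The registered stub `stub_coeff_aFun_eq_sum` of the lead's skeleton: the exact identity for EVERY
component `T ⊆ Fin k` of the dual-number generating function `𝒶 = 𝓮 ⋆ ∏ᵢ 𝒻ᵢ` in
`Λ_k = ℝ[εᵢ]/(εᵢ²)` (tree: `aFun_eq_eFun_mul_prod_fFun`),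

  `[ε_T] 𝒶(m) = Σ_{J ⊆ T} (E^{T∖J} ⋆ F_J)(m)`,

where `E^{U}(n) = [ε_U] 𝓮(n)` (`= compE f (univ ∖ U) n`) and
`F_J = ∏ᵢ (μ gᵢ log if i ∈ J, else μ gᵢ)` (`= compF f J`).  The tree proves the top component
`T = univ` (`coeff_univ_aFun_eq_sum`); the proof here is the same bookkeeping with
`SAlg.coeff_mul_prod_lin` (general component) in place of `SAlg.coeff_univ_mul_prod_lin`.
Everything here is proved. [folklore]
-/

open scoped BigOperators
open Filter Finset Polynomial Asymptotics

namespace Summit.Parity.BatemanHorn.Theorems.PolyMobiusTail.NaturalForm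

open Literature.NumberTheory.Sieve
open Summit.Parity.BatemanHorn.Theorems.TypeIMainTerm

/-- **Stub `stub_coeff_aFun_eq_sum`** (exact identity for every component). From `𝒶 = 𝓮 ⋆ ∏ᵢ 𝒻ᵢ`
(`aFun_eq_eFun_mul_prod_fFun`) and `SAlg.coeff_mul_prod_lin`:
`[ε_T] 𝒶(m) = Σ_{J ⊆ T} ([ε_{T∖J}] 𝓮 ⋆ F_J)(m)`, `F_J = ∏ᵢ (μ gᵢ log if i ∈ J, else μ gᵢ)`; the tree has
the case `T = univ` (`coeff_univ_aFun_eq_sum`). [folklore] -/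
theorem stub_coeff_aFun_eq_sum : ∀ (k : ℕ) (f : Fin k → ℤ[X]) (T : Finset (Fin k)) (m : ℕ),
    Summit.Parity.BatemanHorn.Theorems.TypeIMainTerm.SAlg.coeff (Summit.Parity.BatemanHorn.Theorems.TypeIMainTerm.aFun f m) T =
      ∑ J ∈ T.powerset, (Summit.Parity.BatemanHorn.Theorems.TypeIMainTerm.compE f (Finset.univ \ (T \ J)) * Summit.Parity.BatemanHorn.Theorems.TypeIMainTerm.compF f J) m := by
  intro k f T m
  classical
  rw [aFun_eq_eFun_mul_prod_fFun, ArithmeticFunction.mul_apply, SAlg.coeff_finset_sum]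
  simp_rw [ArithmeticFunction.mul_apply]
  rw [Finset.sum_comm]
  refine Finset.sum_congr rfl fun x _ => ?_
  -- expand `(∏ 𝒻_i)(x.2)` over tuples and extract the `T`-coefficient
  rw [ArithmeticFunction.prod_apply_eq_sum_finMulAntidiag, Finset.mul_sum, SAlg.coeff_finset_sum]
  simp_rw [compE_apply, compF, ArithmeticFunction.prod_apply_eq_sum_finMulAntidiag, Finset.mul_sum]
  rw [Finset.sum_comm]
  refine Finset.sum_congr rfl fun d _ => ?_
  simp_rw [fFun_eq_lin]
  rw [SAlg.coeff_mul_prod_lin, Finset.univ_inter]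
  refine Finset.sum_congr rfl fun J _ => ?_
  rw [Finset.sdiff_sdiff_eq_self (Finset.subset_univ (T \ J)), mul_comm]
  congr 1
  rw [show (∏ i, (if i ∈ J then mgl f i else mg f i) (d i)) =
      ∏ i, (if i ∈ J then mgl f i (d i) else mg f i (d i)) from
      Finset.prod_congr rfl fun i _ => by split_ifs <;> rfl,
    Finset.prod_ite, Finset.filter_mem_eq_inter, Finset.univ_inter]
  congr 1
  refine Finset.prod_congr (by ext i; simp) fun i _ => ?_
  simp only [mg_apply]

end Summit.Parity.BatemanHorn.Theorems.PolyMobiusTail.NaturalForm
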